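import Literature.IUT.HodgeArakelov.BadPlaceSettingOfDoubleUnderline
import Literature.AnabelianGeometry.EtaleTheta.DoubleUnderlineTower

/-!
# Which `X_v`? — the level of `Π^tp_{X_v}` at the [EtTh] model of [IUTchII] Prop 2.1 (kernel witness, proof-only)

S. Mochizuki, *Inter-universal Teichmüller theory II*, kurims manuscript (Dec. 2020), §2: Prop. 2.1 p. 64, Rmk. 2.1.1 (i)
p. 65, Def. 2.3 (i)/(iii) pp. 67–68 ([IUTchII] Def 2.3 (i), kurims p.67) [claim: Mochizuki2012, status: disputed]; *IUT I*,
Def. 3.1 (d)(e) pp. 62–63; [EtTh] Def. 2.1 p. 36, Def. 2.5 (i) p. 39 [cite: MochizukiEtTh2009, Def 2.1 p.36].  PROOF-ONLY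
file (abc-iut cell, seat abc-iut-L6-t19 gen 5; RQ7 soundness lane, finding F-L6t19g5-1); no definitions; nothing landed is
edited; nothing of the disputed series is asserted — the theorems below are elementary index computations over abc-iut-L2's
[EtTh] data (`ThetaSetting`, `EtaleThetaData.DoubleUnderline`).

THE READING AT ISSUE.  In [IUTchII] §2 the curve written "`X_v`" is `X̲_v := X̲_K ×_K K_v` of [IUTchI] Def. 3.1 (d)(e) — of
type `(1, l-tors)` ([EtTh] Def. 2.1: the degree-`l` étale covering `X̲ → X` of the once-punctured elliptic curve `X` given by a
rank-one quotient `Π_X ↠ Q ≅ ℤ/lℤ` that is trivial on the decomposition group of the cusp; at `v ∈ 𝕍^bad` it is the level-`l`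
subcovering of the `ℤ`-covering `Y_v → X_v`, type `(1, ℤ/lℤ)`), NOT the once-punctured elliptic curve itself: Rmk. 2.1.1 (i)
"`Gal(Y_v/X_v)` may be identified with the subgroup `l·ℤ ⊆ ℤ`"; Def. 2.3 (i) "`Π^±_v := Π^tp_{X_v}`", "`Δ̂_v` … normal open subgroup
of `Δ̂^±_v` of index `l` [[EtTh] Prop. 2.2 (ii)]", "`Δ̂^±_v` … of `Δ̂^cor_v` of index `2l`", "`Π^±_v/Π_v ⥲ Gal(X̲̲_v/X_v) (≅ ℤ/lℤ)`";
Def. 2.3 (iii) (`LabCusp^±(Π_v) ≅ 𝔽_l`: `l` cusps).  The underline is lost in text extraction of the kurims PDF.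

THE TREE.  abc-iut-L6-t1's interfaces (`BadPlaceSetting.PiXplain` "`Π^tp_{X_v}` (plain `X_v`)", `TemperedCoverings.Xplain`,
`PlusMinusTower.emb : T.Xplain →* Π̂^cor_v` with `piPM := emb.range` = "`Π^±_v := Π^tp_{X_v}`", `Def23_i_indices` conjunct 3
"`[Π^±_v : Π_v] = l`") are ABSTRACT and consistent with print when `Xplain` is read as `Π^tp_{X̲_v}`.  The ONE model in the tree,
abc-iut-w4-d034's `BadPlaceSetting.ofDoubleUnderline` (p413302), sets `PiXplain := Π^tp_X` = abc-iut-L2's [EtTh] §1 curve `X` of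
type `(1,1)` (`ThetaSetting.PiTemp`, "`Δ_X` is a profinite free group on 2 generators", `toZ : Π^tp_X ↠ ℤ` = `Gal(Y/X) ≅ ℤ`), with
`Π_v := Π^tp_X̲̲ = C.Huu`.  abc-iut-L2 ALREADY carries all three levels in the kernel: abc-iut-L2-t7's
`ThetaSetting.GtpXu D l := toZ⁻¹(l·ℤ) = Π^tp_X̲` (`SingleUnderline.lean`: open, normal, `index_GtpXu : [Π^tp_X : Π^tp_X̲] = l`,
maps onto `G_K`) and `DoubleUnderlineTower.lean` (`Huu_le_GtpXu : Π^tp_X̲̲ ⊆ Π^tp_X̲`, `relIndex_Huu_GtpXu : [Π^tp_X̲ : Π^tp_X̲̲] = l`,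
`index_Huu : [Π^tp_X : Π^tp_X̲̲] = l²` — "extracting two copies of `ℤ/lℤ`", [EtTh] Rmk. 2.3.1).  THIS FILE only transports
those facts to the L6 model's own names (proof-only, BY NAME):

* `BadPlaceSetting.ofDoubleUnderline_range_inclPlain` — the model's `Π_v ↪ PiXplain` has image `Π^tp_X̲̲ = C.Huu`;
* **`BadPlaceSetting.ofDoubleUnderline_index_eq_sq`** — `[PiXplain : Π_v] = l²` at the model, hence
  `BadPlaceSetting.ofDoubleUnderline_index_ne` — `≠ l` (`l` prime): the model's "`Π^tp_{X_v}`" is NOT print's `Π^±_v`, for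
  which `[Π^±_v : Π_v] = l` ([IUTchII] Def. 2.3 (i) "`Π^±_v/Π_v ⥲ Gal(X̲̲_v/X_v) (≅ ℤ/lℤ)`"; abc-iut-L6-t1's `Def23_i_indices`,
  conjunct 3);
* `BadPlaceSetting.ofDoubleUnderline_exists_level` — print's `Π^±_v = Π^tp_{X̲_v}` IS available at the model: the open normal
  subgroup `Π^tp_X̲ = D.GtpXu l` with `Π_v ⊆ Π^tp_X̲`, `[Π^tp_X̲ : Π_v] = l`, `[Π^tp_X : Π^tp_X̲] = l`, containing the reference
  tower `Π^tp_Ÿ ⊆ Π^tp_Y` (so `refY`, `refYdd` are unchanged by the repair).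

CONSEQUENCE (no landed statement is false; interfaces are abstract and no `PlusMinusTower` inhabitant exists): a `PlusMinusTower`
built over `TemperedCoverings (BadPlaceSetting.ofDoubleUnderline …)` with `emb` = the inclusion of `Xplain = Π^tp_X` would make
`Def23_i_indices` (conjunct 3), `Cor24_indices` and the `l`-element label structures of Def. 2.3 (iii)/(v) FALSE at the model
(`X` has one cusp; `X̲_v` has `l`).  REPAIR (owners: abc-iut-w4-d034 lineage for the model, abc-iut-L6-t1 for the docstrings):
read "`X_v`" of [IUTchII] §2 as `X̲_v` throughout, and at the model take `Π^tp_{X_v} := toZ⁻¹(l·ℤ)` (with `refY = Π^tp_Y`,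
`refYdd = Π^tp_Ÿ` unchanged — both lie inside it).  Nothing here takes a side on [IUTchIII] Cor. 3.12; typed ≠ proved.
-/

noncomputable section

namespace Literature.IUT.HodgeArakelov

open Literature.AnabelianGeometry.EtaleTheta

universe u

section Levels

variable {p : ℕ} [Fact p.Prime] {D : Literature.AnabelianGeometry.EtaleTheta.ThetaSetting p}
  {E : D.EtaleThetaData} {l : ℕ} (C : E.DoubleUnderline l) {N : ℕ+} (μ : D.CyclotomeMod l N)
  (hC : D.Compat) (hS : D.Sec2Hyps) (hl : l.Prime) (hp2 : p ≠ 2) (hpl : p ≠ l)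
  (hζ : ∃ ζ : D.K, IsPrimitiveRoot ζ (4 * l)) {η : (C.thetaEnvData μ hC hS).PiYdd → MuN p N}
  (hη : η ∈ (C.thetaEnvData μ hC hS).thetaCocycles)

/-- At abc-iut-w4-d034's model the open injection `Π_v ↪ Π^tp_{X_v}` (`inclPlain`) is the inclusion of
`Π^tp_X̲̲ = C.Huu` into `Π^tp_X`: its image is `C.Huu`. ([IUTchII] Prop 2.1, kurims p.64) [claim: Mochizuki2012, status: disputed] -/
theorem BadPlaceSetting.ofDoubleUnderline_range_inclPlain :
    (BadPlaceSetting.ofDoubleUnderline C μ hC hS hl hp2 hpl hζ hη).inclPlain.range = C.Huu :=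
  Subgroup.range_subtype C.Huu

/-- **`[PiXplain : Π_v] = l²` at the model** ([EtTh] Rmk. 2.3.1 "two copies of `ℤ/lℤ`", abc-iut-L2-t7's `DoubleUnderline.index_Huu`
BY NAME): the group the model calls `Π^tp_{X_v}` lies TWO covering levels of degree `l` above `Π_v`.
([IUTchII] Def 2.3 (i), kurims p.67) [claim: Mochizuki2012, status: disputed] -/
theorem BadPlaceSetting.ofDoubleUnderline_index_eq_sq :
    ((BadPlaceSetting.ofDoubleUnderline C μ hC hS hl hp2 hpl hζ hη).inclPlain.range).index = l ^ 2 := by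
  rw [BadPlaceSetting.ofDoubleUnderline_range_inclPlain]
  exact C.index_Huu

/-- **Hence `[PiXplain : Π_v] ≠ l` at the model** (`l` prime), whereas print's `Π^±_v` has `[Π^±_v : Π_v] = l` ([IUTchII]
Def. 2.3 (i) "`Π^±_v/Π_v ⥲ Gal(X̲̲_v/X_v) (≅ ℤ/lℤ)`"; abc-iut-L6-t1's `Def23_i_indices`, conjunct 3): identifying the model's
`PiXplain` with `Π^±_v` (as "`Π^±_v := Π^tp_{X_v}` = `TemperedCoverings.Xplain`" would) makes that conjunct false there.
([IUTchII] Def 2.3 (i), kurims p.67) [claim: Mochizuki2012, status: disputed] -/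
theorem BadPlaceSetting.ofDoubleUnderline_index_ne :
    ((BadPlaceSetting.ofDoubleUnderline C μ hC hS hl hp2 hpl hζ hη).inclPlain.range).index ≠ l := by
  rw [BadPlaceSetting.ofDoubleUnderline_index_eq_sq, sq]
  intro h
  have h1 : l * l = l * 1 := by rw [mul_one]; exact h
  exact hl.one_lt.ne' (Nat.eq_of_mul_eq_mul_left hl.pos h1)

/-- **Print's `Π^±_v = Π^tp_{X̲_v}` exists at the model**: abc-iut-L2-t7's `Π^tp_X̲ = ThetaSetting.GtpXu D l = toZ⁻¹(l·ℤ)` is an open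
normal subgroup of `Π^tp_X` with `Π_v = Π^tp_X̲̲ ⊆ Π^tp_X̲`, `[Π^tp_X̲ : Π_v] = l` (= Def. 2.3 (i)'s `[Π^±_v : Π_v] = l`),
`[Π^tp_X : Π^tp_X̲] = l`, and it contains the reference tower `Π^tp_Ÿ ⊆ Π^tp_Y` of Prop. 2.1 (the model's `refYdd ⊆ refY`) — the
repair target for `PiXplain`.  All conjuncts are abc-iut-L2 theorems BY NAME. ([IUTchII] Def 2.3 (i), kurims p.67) [claim: Mochizuki2012, status: disputed] -/
theorem BadPlaceSetting.ofDoubleUnderline_exists_level :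
    ∃ H : Subgroup D.PiTemp, IsOpen (H : Set D.PiTemp) ∧ H.Normal ∧ C.Huu ≤ H ∧ C.Huu.relIndex H = l ∧ H.index = l ∧
      (BadPlaceSetting.ofDoubleUnderline C μ hC hS hl hp2 hpl hζ hη).refY ≤ H ∧
      (BadPlaceSetting.ofDoubleUnderline C μ hC hS hl hp2 hpl hζ hη).refYdd ≤ H :=
  ⟨D.GtpXu l, D.isOpen_GtpXu l, inferInstance, C.Huu_le_GtpXu, C.relIndex_Huu_GtpXu, D.index_GtpXu l,
    D.GtpY_le_GtpXu l, le_trans D.GtpYdd_le_GtpY (D.GtpY_le_GtpXu l)⟩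

end Levels

end Literature.IUT.HodgeArakelov

end
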